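import Mathlib
import Summits.NavierStokesRegularity.NavierStokesRegularity.Theorems.FilamentSkeletonRssSkeletonJ1RLiaSelfDerivSplit
import Summits.NavierStokesRegularity.NavierStokesRegularity.Theorems.FilamentSkeletonRssSkeletonJ1RLiaDerivKernelMismatch

/-!
# Crux `SkeletonJ1R` (stmt-NavierStokesRegularity-23610) · line `streamline_kantorovich_R` · toward stub F2-d (`LiaDefectDerivBL`, v7), brick toward S2′/S3′ for B1′:
# POINTWISE MAJORANTS FOR THE SYMMETRIZED SELF-STRAND DERIVATIVE INTEGRAND (outer zones) and the smallness of its radial factor `⟪w, X′τ − X′σ⟫`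

Hand `leafhand-ns-filamentskeletonrs-1` (gen 0), `--supports stmt-NavierStokesRegularity-23610 --as helper`.  MODEL rung, NEGATIVE side of the ladder:
elementary estimates for a HYPOTHETICAL filament-type blow-up skeleton; nothing here is a claim about Navier–Stokes regularity; the stub and the crux stay OPEN.

For the symmetrized integrand `D = (−3⟪w, P − a⟫K₅(w))•a×w + K₃(w)•(a×(P − a) + b×w)` of `…LiaSelfDerivSymm` / `…LiaSelfDerivSplit`
(`a = X′σ` unit, `b = X″σ`, `P = X′τ`, `w = Xτ − Xσ ≠ 0`):
* `norm_symmDerivIntegrand_le` : `‖D‖ ≤ 4‖P − a‖/‖w‖³ + ‖b‖/‖w‖²` (kernel floors `K₅ ≤ ‖w‖⁻⁵`, `K₃ ≤ ‖w‖⁻³`) — the ENVELOPE/FAR-zone majorant of S3′, to be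
  combined with chord–arc `‖w‖ ≥ c|τ − σ|` (`norm_symmDerivIntegrand_le_of_chord`: `≤ 4θ/(c³|τ−σ|³) + κ/(c²(τ−σ)²)` for `‖P − a‖ ≤ θ`, `‖b‖ ≤ κ`);
* `inner_sub_right_of_unit` : `⟪a' − a, a⟫ = −‖a' − a‖²/2` for unit vectors — whence
* `abs_inner_chord_tangentIncrement_le` : `|⟪Xτ − Xσ, X′τ − X′σ⟫| ≤ (3/2)κ²|τ − σ|³` on a segment with curvature `≤ κ` (the radial factor of the first term
  of `D` is THIRD order, so that term is negligible on the logarithmic window of S2′).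
-/

set_option linter.dupNamespace false -- `NavierStokesRegularity.NavierStokesRegularity` path/namespace repetition is the tree convention

noncomputable section

namespace Summit.NavierStokesRegularity.NavierStokesRegularity.Theorems.SkeletonJ1RLiaSelf

open Set Function Filter Real Topology MeasureTheory
open Literature.Analysis.FluidPDE
open Summit.NavierStokesRegularity.NavierStokesRegularity.Theorems.SkeletonJ1RFrame (inv_rpow_normSq_le sq_rpow_neg_half_eq_inv_pow)
open scoped InnerProductSpace BigOperators

/-! ## §1 The outer-zone majorant -/

/-- Kernel floor: `((‖w‖² + q)^{k/2})⁻¹ ≤ (‖w‖^k)⁻¹` for `w ≠ 0`, `q ≥ 0`. [folklore] -/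
theorem inv_rpow_normSq_le_inv_pow {q : ℝ} (hq : 0 ≤ q) {w : EuclideanSpace ℝ (Fin 3)} (hw : 0 < ‖w‖) (k : ℕ) :
    ((‖w‖ ^ 2 + q) ^ ((k : ℝ) / 2))⁻¹ ≤ (‖w‖ ^ k)⁻¹ := by
  have h := inv_rpow_normSq_le (q := q) (p := (k : ℝ) / 2) (by positivity) (by positivity : 0 < ‖w‖ ^ 2) (w := w) (by linarith)
  rwa [sq_rpow_neg_half_eq_inv_pow hw.le k] at h

/-- **OUTER-ZONE MAJORANT** of the symmetrized derivative integrand: `‖D‖ ≤ 4‖P − a‖/‖w‖³ + ‖b‖/‖w‖²` (`‖a‖ = 1`, `w ≠ 0`, `q ≥ 0`). [folklore] -/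
theorem norm_symmDerivIntegrand_le {q : ℝ} (hq : 0 ≤ q) {a b P w : EuclideanSpace ℝ (Fin 3)} (ha : ‖a‖ = 1) (hw : 0 < ‖w‖) :
    ‖(-3 * ⟪w, P - a⟫_ℝ * ((‖w‖ ^ 2 + q) ^ (5 / 2 : ℝ))⁻¹) • cross a w + ((‖w‖ ^ 2 + q) ^ (3 / 2 : ℝ))⁻¹ • (cross a (P - a) + cross b w)‖ ≤
      4 * ‖P - a‖ / ‖w‖ ^ 3 + ‖b‖ / ‖w‖ ^ 2 := by
  have hk5 : ((‖w‖ ^ 2 + q) ^ (5 / 2 : ℝ))⁻¹ ≤ (‖w‖ ^ 5)⁻¹ := by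
    have := inv_rpow_normSq_le_inv_pow hq hw 5; norm_num at this ⊢; exact this
  have hk3 : ((‖w‖ ^ 2 + q) ^ (3 / 2 : ℝ))⁻¹ ≤ (‖w‖ ^ 3)⁻¹ := by
    have := inv_rpow_normSq_le_inv_pow hq hw 3; norm_num at this ⊢; exact this
  have hk5_0 : 0 ≤ ((‖w‖ ^ 2 + q) ^ (5 / 2 : ℝ))⁻¹ := inv_nonneg.2 (Real.rpow_nonneg (by positivity) _)
  have hk3_0 : 0 ≤ ((‖w‖ ^ 2 + q) ^ (3 / 2 : ℝ))⁻¹ := inv_nonneg.2 (Real.rpow_nonneg (by positivity) _)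
  have hin : |⟪w, P - a⟫_ℝ| ≤ ‖w‖ * ‖P - a‖ := abs_real_inner_le_norm _ _
  have hcw : ‖cross a w‖ ≤ ‖w‖ := by
    have := norm_cross_le_norm_mul_norm a w; rwa [ha, one_mul] at this
  have hcP : ‖cross a (P - a)‖ ≤ ‖P - a‖ := by
    have := norm_cross_le_norm_mul_norm a (P - a); rwa [ha, one_mul] at this
  have hcb : ‖cross b w‖ ≤ ‖b‖ * ‖w‖ := norm_cross_le_norm_mul_norm b w
  have hw3 : 0 < ‖w‖ ^ 3 := by positivity
  have hw5 : 0 < ‖w‖ ^ 5 := by positivity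
  -- first term
  have h1 : ‖(-3 * ⟪w, P - a⟫_ℝ * ((‖w‖ ^ 2 + q) ^ (5 / 2 : ℝ))⁻¹) • cross a w‖ ≤ 3 * ‖P - a‖ / ‖w‖ ^ 3 := by
    rw [norm_smul, Real.norm_eq_abs, abs_mul, abs_mul, abs_neg, abs_of_pos (by norm_num : (0:ℝ) < 3), abs_of_nonneg hk5_0]
    calc 3 * |⟪w, P - a⟫_ℝ| * ((‖w‖ ^ 2 + q) ^ (5 / 2 : ℝ))⁻¹ * ‖cross a w‖
        ≤ 3 * (‖w‖ * ‖P - a‖) * (‖w‖ ^ 5)⁻¹ * ‖w‖ := by gcongr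
      _ = 3 * ‖P - a‖ / ‖w‖ ^ 3 := by field_simp
  -- second term
  have h2 : ‖((‖w‖ ^ 2 + q) ^ (3 / 2 : ℝ))⁻¹ • (cross a (P - a) + cross b w)‖ ≤ ‖P - a‖ / ‖w‖ ^ 3 + ‖b‖ / ‖w‖ ^ 2 := by
    rw [norm_smul, Real.norm_of_nonneg hk3_0]
    calc ((‖w‖ ^ 2 + q) ^ (3 / 2 : ℝ))⁻¹ * ‖cross a (P - a) + cross b w‖
        ≤ (‖w‖ ^ 3)⁻¹ * (‖P - a‖ + ‖b‖ * ‖w‖) :=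
          mul_le_mul hk3 ((norm_add_le _ _).trans (add_le_add hcP hcb)) (norm_nonneg _) (by positivity)
      _ = ‖P - a‖ / ‖w‖ ^ 3 + ‖b‖ / ‖w‖ ^ 2 := by field_simp
  calc _ ≤ ‖(-3 * ⟪w, P - a⟫_ℝ * ((‖w‖ ^ 2 + q) ^ (5 / 2 : ℝ))⁻¹) • cross a w‖ +
        ‖((‖w‖ ^ 2 + q) ^ (3 / 2 : ℝ))⁻¹ • (cross a (P - a) + cross b w)‖ := norm_add_le _ _
    _ ≤ 3 * ‖P - a‖ / ‖w‖ ^ 3 + (‖P - a‖ / ‖w‖ ^ 3 + ‖b‖ / ‖w‖ ^ 2) := add_le_add h1 h2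
    _ = 4 * ‖P - a‖ / ‖w‖ ^ 3 + ‖b‖ / ‖w‖ ^ 2 := by ring

/-- The outer-zone majorant with chord–arc: `‖D‖ ≤ 4θ/(c³|τ−σ|³) + κ/(c²(τ−σ)²)` when `c|τ − σ| ≤ ‖w‖`, `‖P − a‖ ≤ θ`, `‖b‖ ≤ κ`, `τ ≠ σ`. [folklore] -/
theorem norm_symmDerivIntegrand_le_of_chord {q : ℝ} (hq : 0 ≤ q) {a b P w : EuclideanSpace ℝ (Fin 3)} (ha : ‖a‖ = 1) {c τ σ θ κ : ℝ}
    (hc : 0 < c) (hτσ : τ ≠ σ) (hchord : c * |τ - σ| ≤ ‖w‖) (hθ : ‖P - a‖ ≤ θ) (hκ : ‖b‖ ≤ κ) :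
    ‖(-3 * ⟪w, P - a⟫_ℝ * ((‖w‖ ^ 2 + q) ^ (5 / 2 : ℝ))⁻¹) • cross a w + ((‖w‖ ^ 2 + q) ^ (3 / 2 : ℝ))⁻¹ • (cross a (P - a) + cross b w)‖ ≤
      4 * θ / (c ^ 3 * |τ - σ| ^ 3) + κ / (c ^ 2 * (τ - σ) ^ 2) := by
  have hs : 0 < |τ - σ| := abs_pos.2 (sub_ne_zero.2 hτσ)
  have hcs : 0 < c * |τ - σ| := by positivity
  have hw : 0 < ‖w‖ := hcs.trans_le hchord
  have h := norm_symmDerivIntegrand_le hq (b := b) (P := P) ha hw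
  have hθ0 : 0 ≤ θ := (norm_nonneg _).trans hθ
  have hκ0 : 0 ≤ κ := (norm_nonneg _).trans hκ
  have h3 : (c * |τ - σ|) ^ 3 ≤ ‖w‖ ^ 3 := pow_le_pow_left₀ hcs.le hchord 3
  have h2 : (c * |τ - σ|) ^ 2 ≤ ‖w‖ ^ 2 := pow_le_pow_left₀ hcs.le hchord 2
  have t1 : 4 * ‖P - a‖ / ‖w‖ ^ 3 ≤ 4 * θ / (c ^ 3 * |τ - σ| ^ 3) := by
    rw [show c ^ 3 * |τ - σ| ^ 3 = (c * |τ - σ|) ^ 3 by ring]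
    exact div_le_div₀ (by positivity) (by linarith) (by positivity) h3
  have t2 : ‖b‖ / ‖w‖ ^ 2 ≤ κ / (c ^ 2 * (τ - σ) ^ 2) := by
    rw [show c ^ 2 * (τ - σ) ^ 2 = (c * |τ - σ|) ^ 2 by rw [mul_pow, sq_abs]]
    exact div_le_div₀ hκ0 hκ (by positivity) h2
  exact h.trans (add_le_add t1 t2)

/-! ## §2 The radial factor `⟪w, X′τ − X′σ⟫` is third order -/

/-- For unit vectors, `⟪a' − a, a⟫ = −‖a' − a‖²/2`. [folklore] -/
theorem inner_sub_right_of_unit {a a' : EuclideanSpace ℝ (Fin 3)} (ha : ‖a‖ = 1) (ha' : ‖a'‖ = 1) :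
    ⟪a' - a, a⟫_ℝ = -‖a' - a‖ ^ 2 / 2 := by
  have h1 : ‖a' - a‖ ^ 2 = ‖a'‖ ^ 2 - 2 * ⟪a', a⟫_ℝ + ‖a‖ ^ 2 := norm_sub_sq_real a' a
  rw [inner_sub_left, real_inner_self_eq_norm_sq, h1, ha, ha']
  ring

variable {X : ℝ → EuclideanSpace ℝ (Fin 3)}

/-- **`|⟪Xτ − Xσ, X′τ − X′σ⟫| ≤ (3/2)κ²|τ − σ|³`** for a unit-speed `C²` curve with `‖X″‖ ≤ κ` on `[[σ, τ]]`: the chord is `(τ−σ)X′σ + O(κ(τ−σ)²)`,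
the tangent increment is `O(κ|τ−σ|)` and exactly `⟪X′τ − X′σ, X′σ⟫ = −‖X′τ − X′σ‖²/2`. [folklore] -/
theorem abs_inner_chord_tangentIncrement_le (hX : ContDiff ℝ 2 X) (hunit : ∀ s, ‖deriv X s‖ = 1) {τ σ κ : ℝ}
    (hκ : ∀ p ∈ uIcc σ τ, ‖deriv (deriv X) p‖ ≤ κ) :
    |⟪X τ - X σ, deriv X τ - deriv X σ⟫_ℝ| ≤ 3 / 2 * κ ^ 2 * |τ - σ| ^ 3 := by
  have hκ0 : 0 ≤ κ := (norm_nonneg _).trans (hκ σ left_mem_uIcc)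
  set d := deriv X τ - deriv X σ with hd
  set T₂ := X τ - X σ - (τ - σ) • deriv X σ with hT₂
  have hdn : ‖d‖ ≤ κ * |τ - σ| := norm_deriv_sub_deriv_le_on hX (τ := σ) (σ := τ) hκ
  have hT₂n : ‖T₂‖ ≤ κ * (τ - σ) ^ 2 := norm_taylorTwo_le_of_curvature hX (τ := σ) (σ := τ) hκ
  have hsplit : X τ - X σ = (τ - σ) • deriv X σ + T₂ := by rw [hT₂]; abel
  have hunitσ : ⟪d, deriv X σ⟫_ℝ = -‖d‖ ^ 2 / 2 := inner_sub_right_of_unit (hunit σ) (hunit τ)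
  rw [hsplit, inner_add_left, inner_smul_left, real_inner_comm d (deriv X σ), hunitσ]
  simp only [conj_trivial]
  have hA : |(τ - σ) * (-‖d‖ ^ 2 / 2)| ≤ |τ - σ| * (κ * |τ - σ|) ^ 2 / 2 := by
    rw [abs_mul, show |-‖d‖ ^ 2 / 2| = ‖d‖ ^ 2 / 2 by rw [abs_div, abs_neg, abs_pow, abs_norm, abs_two], ← mul_div_assoc]
    gcongr
  have hB : |⟪T₂, d⟫_ℝ| ≤ κ * (τ - σ) ^ 2 * (κ * |τ - σ|) :=
    (abs_real_inner_le_norm _ _).trans (mul_le_mul hT₂n hdn (norm_nonneg _) (by positivity))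
  calc |(τ - σ) * (-‖d‖ ^ 2 / 2) + ⟪T₂, d⟫_ℝ| ≤ |(τ - σ) * (-‖d‖ ^ 2 / 2)| + |⟪T₂, d⟫_ℝ| := abs_add_le _ _
    _ ≤ |τ - σ| * (κ * |τ - σ|) ^ 2 / 2 + κ * (τ - σ) ^ 2 * (κ * |τ - σ|) := add_le_add hA hB
    _ = 3 / 2 * κ ^ 2 * |τ - σ| ^ 3 := by rw [← sq_abs (τ - σ)]; ring

end Summit.NavierStokesRegularity.NavierStokesRegularity.Theorems.SkeletonJ1RLiaSelf

end
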